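import Mathlib
import Summits.ValiantsHypothesis.ValiantsHypothesis.Theorems.LiouvilleSarnakAlignedTypeICharactersMod2nBilinearSieveVonMangoldt
import Summits.ValiantsHypothesis.ValiantsHypothesis.Theorems.LiouvilleSarnakAlignedTypeICharactersMod2nBilinearSievePrimitive
import HarnessLib

/-!
# Route LiouvilleSarnak — support `AlignedTypeI` (stmt-ValiantsHypothesis-21040), line `characters_mod_2n`:
# the leaf from von Mangoldt-weighted character sums `ψ(t, χ)` of primitive characters to `2`-power moduli

Last reduction of the chain `…BilinearSieveAssembly` → `…PCS` → `…Primitive`: the hypothesis is moved from `θ(t, χ) = Σ_{p≤t}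
(log p)χ(p)` to `ψ(t, χ) = Σ_{n ≤ t} Λ(n) χ(n)` (the currency of Banks–Shparlinski 2019 Thm 2.2 and of Siegel–Walfisz), using
`norm_sum_vonMangoldt_sub_logWeighted_le` (`ψ − θ ≤ 2√t log t`, Mathlib's Chebyshev) and `log t ≤ 4 t^{1/4}`:

  H_Λ := ∀ θ>0 ∀ η>0 ∃ k₁ ∀ k ≥ k₁ ∀ 1 ≤ j ≤ k ∀ χ primitive (mod 2^j) ∀ a ≥ θk ∀ t ≥ 2^a (t : ℕ):
           ‖Σ_{n ∈ (0, t]} Λ(n) χ(n)‖ ≤ η t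
  ★ `alignedTypeI_of_vonMangoldtPrimeCharSums : H_Λ → AlignedTypeI` (conditional by arrow, no def).

What remains for an unconditional-modulo-citation closure: H_Λ from the named fact
`Literature.NumberTheory.LFunctions.BanksShparlinski2019_theorem22_twoPower_vonMangoldt` (conductors `2^j`, `j ≥ γ₀`: a
uniformisation of its three ranges over `t ≥ 2^{θk}`, pure real analysis) together with the landed
`norm_sum_vonMangoldt_char_le_of_siegelWalfisz` (conductors `2^j`, `j < γ₀`).

HONEST FRAMING. Bookkeeping only; `AlignedTypeI` is NOT closed here; nothing bears on `VP ≠ VNP` (NOT proved).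
-/

set_option linter.dupNamespace false

noncomputable section

namespace Summit.ValiantsHypothesis.ValiantsHypothesis.Theorems.LiouvilleSarnak.AlignedTypeI.CharactersModTwoN

open Finset ArithmeticFunction
open scoped BigOperators

/-- `2 √t log t ≤ ε t` once `t^{1/4} ≥ 32/ε`... precisely: for real `t > 0` with `√√t ≥ 16/ε`, `2 √t log t ≤ ε t / 2`. [folklore] -/
theorem two_sqrt_mul_log_le {t ε : ℝ} (ht : 0 < t) (hε : 0 < ε) (hw : 16 / ε ≤ Real.sqrt (Real.sqrt t)) :
    2 * Real.sqrt t * Real.log t ≤ ε * t / 2 := by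
  set w := Real.sqrt (Real.sqrt t) with hwdef
  have hw0 : 0 ≤ w := Real.sqrt_nonneg _
  have hw2 : w ^ 2 = Real.sqrt t := Real.sq_sqrt (Real.sqrt_nonneg _)
  have hw4 : w ^ 4 = t := by
    calc w ^ 4 = (w ^ 2) ^ 2 := by ring
      _ = t := by rw [hw2, Real.sq_sqrt ht.le]
  have hlog : Real.log t ≤ 4 * w := log_le_four_mul_sqrt_sqrt ht
  have hεw : 16 ≤ ε * w := by
    have := (div_le_iff₀ hε).mp hw
    linarith
  have hst : 0 ≤ Real.sqrt t := Real.sqrt_nonneg _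
  calc 2 * Real.sqrt t * Real.log t ≤ 2 * Real.sqrt t * (4 * w) := by gcongr
    _ = 8 * w ^ 3 := by rw [← hw2]; ring
    _ ≤ ε * w ^ 4 / 2 := by
        have h := mul_nonneg (pow_nonneg hw0 3) (show (0 : ℝ) ≤ ε * w - 16 by linarith)
        have h' : w ^ 3 * (ε * w - 16) = ε * w ^ 4 - 16 * w ^ 3 := by ring
        rw [h'] at h
        linarith
    _ = ε * t / 2 := by rw [hw4]

/-- **From `ψ(t, χ)` to `θ(t, χ)` bounds, uniformly in the leaf's regime.** [folklore] -/
theorem primitiveLogWeighted_of_vonMangoldt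
    (h : ∀ th : ℝ, 0 < th → ∀ η : ℝ, 0 < η → ∃ k₁ : ℕ, ∀ k : ℕ, k₁ ≤ k → ∀ j : ℕ, 1 ≤ j → j ≤ k →
      ∀ χ : DirichletCharacter ℂ (2 ^ j), χ.IsPrimitive → ∀ a : ℕ, th * k ≤ a → ∀ t : ℕ, 2 ^ a ≤ t →
        ‖∑ n ∈ Finset.Ioc 0 t, ((vonMangoldt n : ℝ) : ℂ) * χ (n : ZMod (2 ^ j))‖ ≤ η * t) :
    ∀ th : ℝ, 0 < th → ∀ η : ℝ, 0 < η → ∃ k₁ : ℕ, ∀ k : ℕ, k₁ ≤ k → ∀ j : ℕ, 1 ≤ j → j ≤ k →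
      ∀ χ : DirichletCharacter ℂ (2 ^ j), χ.IsPrimitive → ∀ a : ℕ, th * k ≤ a → ∀ t : ℕ, 2 ^ a ≤ t →
        ‖∑ p ∈ (Finset.Iic t).filter Nat.Prime, (Real.log p : ℂ) * χ (p : ZMod (2 ^ j))‖ ≤ η * t := by
  intro th hth η hη
  obtain ⟨k₁, hk₁⟩ := h th hth (η / 2) (by positivity)
  -- size threshold: `2^a ≥ (16/ε)^4`-ish, via `a ≥ N`, `θ k ≥ N`
  obtain ⟨N, hN⟩ : ∃ N : ℕ, (16 / η) ^ 4 < (2 : ℝ) ^ N := pow_unbounded_of_one_lt _ (by norm_num : (1 : ℝ) < 2)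
  obtain ⟨K, hK⟩ : ∃ K : ℕ, (N : ℝ) / th ≤ K := exists_nat_ge _
  refine ⟨max k₁ K, fun k hk j hj1 hjk χ hχ a ha t ht => ?_⟩
  have hk₁k : k₁ ≤ k := le_trans (le_max_left _ _) hk
  have hKk : K ≤ k := le_trans (le_max_right _ _) hk
  have haN : N ≤ a := by
    have h1 : (N : ℝ) ≤ th * K := by rwa [div_le_iff₀ hth, mul_comm] at hK
    have h2 : th * K ≤ th * k := mul_le_mul_of_nonneg_left (by exact_mod_cast hKk) hth.le
    exact_mod_cast h1.trans (h2.trans ha)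
  have hmain := hk₁ k hk₁k j hj1 hjk χ hχ a ha t ht
  -- `t ≥ 1`, real facts
  have ht1 : 1 ≤ t := le_trans Nat.one_le_two_pow ht
  have htR : (2 : ℝ) ^ a ≤ t := by exact_mod_cast ht
  have ht0 : (0 : ℝ) < t := by exact_mod_cast (show 0 < t by omega)
  have hdiff := norm_sum_vonMangoldt_sub_logWeighted_le (fun n => χ (n : ZMod (2 ^ j))) (fun n => χ.norm_le_one _) t ht1
  -- `√√t ≥ 16/η`
  have hw : 16 / η ≤ Real.sqrt (Real.sqrt t) := by
    have h1 : (16 / η) ^ 4 ≤ (t : ℝ) :=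
      hN.le.trans ((pow_le_pow_right₀ (by norm_num) haN).trans htR)
    have h16 : 0 ≤ 16 / η := by positivity
    have hs0 : 0 ≤ Real.sqrt (Real.sqrt (t : ℝ)) := Real.sqrt_nonneg _
    have hs4 : Real.sqrt (Real.sqrt (t : ℝ)) ^ 4 = (t : ℝ) := by
      have h2 : Real.sqrt (Real.sqrt (t : ℝ)) ^ 2 = Real.sqrt (t : ℝ) := Real.sq_sqrt (Real.sqrt_nonneg _)
      calc Real.sqrt (Real.sqrt (t : ℝ)) ^ 4 = (Real.sqrt (Real.sqrt (t : ℝ)) ^ 2) ^ 2 := by ring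
        _ = (t : ℝ) := by rw [h2, Real.sq_sqrt ht0.le]
    by_contra hlt
    rw [not_le] at hlt
    have : Real.sqrt (Real.sqrt (t : ℝ)) ^ 4 < (16 / η) ^ 4 := pow_lt_pow_left₀ hlt hs0 (by norm_num)
    linarith
  have herr := two_sqrt_mul_log_le ht0 hη hw
  calc ‖∑ p ∈ (Finset.Iic t).filter Nat.Prime, (Real.log p : ℂ) * χ (p : ZMod (2 ^ j))‖
      ≤ ‖∑ n ∈ Finset.Ioc 0 t, ((vonMangoldt n : ℝ) : ℂ) * χ (n : ZMod (2 ^ j))‖ +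
          ‖∑ n ∈ Finset.Ioc 0 t, ((vonMangoldt n : ℝ) : ℂ) * χ (n : ZMod (2 ^ j)) -
            ∑ p ∈ (Finset.Iic t).filter Nat.Prime, (Real.log p : ℂ) * χ (p : ZMod (2 ^ j))‖ := by
        have := norm_sub_le (∑ n ∈ Finset.Ioc 0 t, ((vonMangoldt n : ℝ) : ℂ) * χ (n : ZMod (2 ^ j)))
          (∑ n ∈ Finset.Ioc 0 t, ((vonMangoldt n : ℝ) : ℂ) * χ (n : ZMod (2 ^ j)) -
            ∑ p ∈ (Finset.Iic t).filter Nat.Prime, (Real.log p : ℂ) * χ (p : ZMod (2 ^ j)))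
        rwa [sub_sub_cancel] at this
    _ ≤ η / 2 * t + 2 * Real.sqrt t * Real.log t := add_le_add hmain hdiff
    _ ≤ η / 2 * t + η * t / 2 := by linarith
    _ = η * t := by ring

/-- **`AlignedTypeI` from `ψ(t, χ)`-bounds for primitive characters to `2`-power moduli** (CONDITIONAL by arrow, no def):
if for all `θ, η > 0` there is `k₁` with `‖Σ_{n ≤ t} Λ(n) χ(n)‖ ≤ η t` for all `k ≥ k₁`, `1 ≤ j ≤ k`, primitive `χ (mod 2^j)`,
`a ≥ θk`, `t ≥ 2^a` — Banks–Shparlinski 2019 Thm 2.2 (conductors `2^j`, `j ≥ γ₀`, three ranges uniformised) plus Siegel–Walfisz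
(`j < γ₀`, landed as `norm_sum_vonMangoldt_char_le_of_siegelWalfisz`) — then the leaf `AlignedTypeI` holds. [folklore] -/
theorem alignedTypeI_of_vonMangoldtPrimeCharSums
    (h : ∀ th : ℝ, 0 < th → ∀ η : ℝ, 0 < η → ∃ k₁ : ℕ, ∀ k : ℕ, k₁ ≤ k → ∀ j : ℕ, 1 ≤ j → j ≤ k →
      ∀ χ : DirichletCharacter ℂ (2 ^ j), χ.IsPrimitive → ∀ a : ℕ, th * k ≤ a → ∀ t : ℕ, 2 ^ a ≤ t →
        ‖∑ n ∈ Finset.Ioc 0 t, ((vonMangoldt n : ℝ) : ℂ) * χ (n : ZMod (2 ^ j))‖ ≤ η * t) :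
    Summit.ValiantsHypothesis.ValiantsHypothesis.Theses.LiouvilleSarnak.AlignedTypeI :=
  alignedTypeI_of_primitiveLogWeightedPrimeCharSums (primitiveLogWeighted_of_vonMangoldt h)

end Summit.ValiantsHypothesis.ValiantsHypothesis.Theorems.LiouvilleSarnak.AlignedTypeI.CharactersModTwoN
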